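import Summits.QuantumFields.BalabanUV.Beta.FP.TorusCombRows

/-!
# `BalabanUV.Beta.FP.TorusCombNested` — road «FP» for binder row D1, ROUTE T, RULING R-FP-52 (2): THE RESIDUAL PARAMETERS OF A COMPOSITE BLOCKING SPLIT AS
# «SMALL-BLOCK ROOTS THAT ARE NOT BIG-BLOCK ROOTS» ⊕ «SMALL-BLOCK NON-ROOTS» — the `ρ₂ ⊕ ρ₁` sorting of the one-shot comb slice `P` in the OWNER's
# `NestedStepLawOneShot(Jets)` (`secondVar_kkt_fromRows_reindex`; X2 INFO-1 of C-d1leaf06g16-2)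

HONEST DEPENDENCY (page 1, mandatory): continuum YM on T⁴ ⇐ BetaPertH ∧ nine spine estimates (0/9 proved); BetaPertH ⇐ (D1) ∧ (D4) ∧ CAP+tail;
G-an2-4 gates asym, D1 and NE2/3/4.  HONEST FRAMING (cell contract, verbatim): «discharging `BetaPertH` makes Bałaban's UV stability UNCONDITIONAL —
a real constructive-QFT result; it is NOT the continuum limit and NOT the Clay problem.»  ABSOLUTE RULE (cell charter, verbatim): «No internally-minted
statement may enter as a cited fact. Every hypothesis is either kernel-proved in this package or a verbatim quotation of a PUBLISHED theorem with page
reference. The manuscript(s) under audit are NOT citable for their own disputed steps — they are the thing under adjudication; programme-internal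
(2001/route/tribunal) claims are never citable.»  THIS MODULE is [folklore] bookkeeping over `FP/TorusCombForest` ∕ `FP/TorusCombRows`: for two blockings `N` (small) and
`K` with `N ∣ K` (big, e.g. `K = N·Lc^m`) whose root offsets are compatible (`N ∣ ρ'_i − ρ_i`), every big-block root is a small-block root, so the big residual type splits.
No `def … : Prop`, nothing cited, 0 sorry.  «not in print; our bookkeeping».

CONTENT (every `d`; `0 < N`, `0 ≤ ρ_i < N`, `N ∣ K`, `N ∣ ρ'_i − ρ_i`).
* §1 `eq_rootOf_small_of_eq_rootOf_big` (a `(ρ', K)`-root is a `(ρ, N)`-root), `ne_rootOf_big_of_ne_rootOf_small`.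
* §2 [our object — bookkeeping] `resOfSmall : Res ρ N M → Res ρ' K M` (a small non-root is a big non-root), `SmallRoot ρ N (s : Res ρ' K M) : Prop`-free presentation as the
  decidable equation `s.site = rootOf ρ N s.site`; **`resNestedEquiv : Res ρ' K M ≃ {s : Res ρ' K M // s.site = rootOf ρ N s.site} ⊕ Res ρ N M`** (`Equiv.sumCompl` on that
  equation, then the complement identified with `Res ρ N M`); `resNestedEquiv_symm_inr_site` (the embedding of the small residual parameters preserves the site).
The first summand («small-block roots inside the big block, not the big root») is the block-level parameter type `ρ₂`; gan24-leaf-05's `coarsePt` (`TorusGaugeCovarianceCoarse`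
p309586) carries it to the coarse box when the dictionary wants `μ`-coordinates — not here.  0 estimates; 0∕4 row-D1 binders; NOT the one-shot comb rows' values on the two
summands (that is `combRowsT` at blocking `K`, already in the tree), NOT (T-ID) complete, NOT SDF, NOT D1, NOT BetaPertH, NOT continuum, NOT Clay.
Provenance: D1 formalisation swarm LEAF PROVER 06, unit b2b-balaban-beta-d1-formalise-leaf-06 gen 16, 2026-08-22.  No existing file touched.
-/

noncomputable section

namespace Summit.QuantumFields.BalabanUV.Beta.FP.TorusCombNested

open Literature.MathematicalPhysics.QuantumFieldTheory.Balaban1983to89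
open Literature.MathematicalPhysics.QuantumFieldTheory.Balaban1983to89.Beta
open AffineAveraging (Site)
open B6Lemma24Torus (pbox)
open Summit.QuantumFields.BalabanUV.Beta.FP.TorusCombForest
open Summit.QuantumFields.BalabanUV.Beta.FP.TorusCombRows

variable {d : ℕ} {ρ ρ' : Site (d + 1)} {N K : ℕ} {M : Fin (d + 1) → ℕ}

/-! ## §1 Big-block roots are small-block roots -/

/-- [folklore] **A BIG-BLOCK ROOT IS A SMALL-BLOCK ROOT** when `N ∣ K` and the root offsets are compatible modulo `N`. -/
theorem eq_rootOf_small_of_eq_rootOf_big (hN : 0 < N) (hρ : ∀ i, 0 ≤ ρ i ∧ ρ i < N) (hK : 0 < K) (hρ' : ∀ i, 0 ≤ ρ' i ∧ ρ' i < K)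
    (hNK : N ∣ K) (hcomp : ∀ i, (N : ℤ) ∣ ρ' i - ρ i) {x : Site (d + 1)} (hx : x = rootOf ρ' K x) : x = rootOf ρ N x := by
  rw [eq_rootOf_iff_dvd hN hρ]
  rw [eq_rootOf_iff_dvd hK hρ'] at hx
  intro i
  obtain ⟨a, ha⟩ := hx i
  obtain ⟨b, hb⟩ := hcomp i
  obtain ⟨c, hc⟩ := hNK
  refine ⟨(c : ℤ) * a + b, ?_⟩
  have : x i - ρ i = (x i - ρ' i) + (ρ' i - ρ i) := by ring
  rw [this, ha, hb, hc]; push_cast; ring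

/-- [folklore] … contrapositive: a small-block NON-root is a big-block non-root. -/
theorem ne_rootOf_big_of_ne_rootOf_small (hN : 0 < N) (hρ : ∀ i, 0 ≤ ρ i ∧ ρ i < N) (hK : 0 < K) (hρ' : ∀ i, 0 ≤ ρ' i ∧ ρ' i < K)
    (hNK : N ∣ K) (hcomp : ∀ i, (N : ℤ) ∣ ρ' i - ρ i) {x : Site (d + 1)} (hx : x ≠ rootOf ρ N x) : x ≠ rootOf ρ' K x :=
  fun h => hx (eq_rootOf_small_of_eq_rootOf_big hN hρ hK hρ' hNK hcomp h)

/-! ## §2 The sorting `Res(big) ≃ (small roots, not big roots) ⊕ Res(small)` -/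

/-- [our object — bookkeeping] **A SMALL-BLOCK RESIDUAL PARAMETER IS A BIG-BLOCK RESIDUAL PARAMETER.** -/
def resOfSmall (hN : 0 < N) (hρ : ∀ i, 0 ≤ ρ i ∧ ρ i < N) (hK : 0 < K) (hρ' : ∀ i, 0 ≤ ρ' i ∧ ρ' i < K) (hNK : N ∣ K)
    (hcomp : ∀ i, (N : ℤ) ∣ ρ' i - ρ i) (x : Res ρ N M) : Res ρ' K M :=
  ⟨x.1, ne_rootOf_big_of_ne_rootOf_small hN hρ hK hρ' hNK hcomp x.not_root⟩

/-- the embedding preserves the site. -/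
theorem resOfSmall_site (hN : 0 < N) (hρ : ∀ i, 0 ≤ ρ i ∧ ρ i < N) (hK : 0 < K) (hρ' : ∀ i, 0 ≤ ρ' i ∧ ρ' i < K) (hNK : N ∣ K)
    (hcomp : ∀ i, (N : ℤ) ∣ ρ' i - ρ i) (x : Res ρ N M) : (resOfSmall hN hρ hK hρ' hNK hcomp x).site = x.site := rfl

/-- [our object — bookkeeping] **THE COMPLEMENT OF THE SMALL-BLOCK ROOTS AMONG THE BIG RESIDUAL PARAMETERS IS `Res ρ N M`.** -/
def resNotSmallRootEquiv (hN : 0 < N) (hρ : ∀ i, 0 ≤ ρ i ∧ ρ i < N) (hK : 0 < K) (hρ' : ∀ i, 0 ≤ ρ' i ∧ ρ' i < K) (hNK : N ∣ K)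
    (hcomp : ∀ i, (N : ℤ) ∣ ρ' i - ρ i) :
    {s : Res ρ' K M // ¬ s.site = rootOf ρ N s.site} ≃ Res ρ N M where
  toFun s := ⟨s.1.1, s.2⟩
  invFun x := ⟨resOfSmall hN hρ hK hρ' hNK hcomp x, x.not_root⟩
  left_inv s := by apply Subtype.ext; apply Subtype.ext; rfl
  right_inv x := by apply Subtype.ext; rfl

/-- [our object — bookkeeping] **THE `ρ₂ ⊕ ρ₁` SORTING OF THE BIG RESIDUAL PARAMETERS**: small-block roots that are not big-block roots ⊕ small-block non-roots. -/
def resNestedEquiv (hN : 0 < N) (hρ : ∀ i, 0 ≤ ρ i ∧ ρ i < N) (hK : 0 < K) (hρ' : ∀ i, 0 ≤ ρ' i ∧ ρ' i < K) (hNK : N ∣ K)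
    (hcomp : ∀ i, (N : ℤ) ∣ ρ' i - ρ i) :
    Res ρ' K M ≃ {s : Res ρ' K M // s.site = rootOf ρ N s.site} ⊕ Res ρ N M :=
  (Equiv.sumCompl fun s : Res ρ' K M => s.site = rootOf ρ N s.site).symm.trans
    (Equiv.sumCongr (Equiv.refl _) (resNotSmallRootEquiv hN hρ hK hρ' hNK hcomp))

/-- [folklore] the sorting sends a small residual parameter (right summand) back to the same site. -/
theorem resNestedEquiv_symm_inr_site (hN : 0 < N) (hρ : ∀ i, 0 ≤ ρ i ∧ ρ i < N) (hK : 0 < K) (hρ' : ∀ i, 0 ≤ ρ' i ∧ ρ' i < K) (hNK : N ∣ K)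
    (hcomp : ∀ i, (N : ℤ) ∣ ρ' i - ρ i) (x : Res ρ N M) :
    ((resNestedEquiv (M := M) hN hρ hK hρ' hNK hcomp).symm (Sum.inr x)).site = x.site := rfl

/-- [folklore] … and a small root (left summand) to its own site. -/
theorem resNestedEquiv_symm_inl_site (hN : 0 < N) (hρ : ∀ i, 0 ≤ ρ i ∧ ρ i < N) (hK : 0 < K) (hρ' : ∀ i, 0 ≤ ρ' i ∧ ρ' i < K) (hNK : N ∣ K)
    (hcomp : ∀ i, (N : ℤ) ∣ ρ' i - ρ i) (s : {s : Res ρ' K M // s.site = rootOf ρ N s.site}) :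
    ((resNestedEquiv (M := M) hN hρ hK hρ' hNK hcomp).symm (Sum.inl s)).site = s.1.site := rfl

/-- [folklore] cardinalities: `#Res(big) = #(small roots, not big roots) + #Res(small)`. -/
theorem card_res_big (hN : 0 < N) (hρ : ∀ i, 0 ≤ ρ i ∧ ρ i < N) (hK : 0 < K) (hρ' : ∀ i, 0 ≤ ρ' i ∧ ρ' i < K) (hNK : N ∣ K)
    (hcomp : ∀ i, (N : ℤ) ∣ ρ' i - ρ i) :
    Fintype.card (Res ρ' K M) = Fintype.card {s : Res ρ' K M // s.site = rootOf ρ N s.site} + Fintype.card (Res ρ N M) := by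
  rw [Fintype.card_congr (resNestedEquiv (M := M) hN hρ hK hρ' hNK hcomp), Fintype.card_sum]

end Summit.QuantumFields.BalabanUV.Beta.FP.TorusCombNested

end
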